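import Summits.Ventures.PercRepro.OrbitK

/-!
# PercRepro — two counting inputs of Theorem C (C-025 at bounded corank and large rank) (night-1, gen 0)

`proofs/NIGHT-1-C025-induction.md` §10:

* **`phiK_le_two_pow_div`** — `Φ(p, q) ≤ 2^{p+q} / C(p+q, p)` (the numerator `Σ_{q<u<p} C(p+q, u)` is part of the full
  binomial sum `2^{p+q}`);
* **`encard_add_eRank_le`** (nullity is monotone, additive form) — for `X ⊆ E`, `|X| + r(E) ≤ |E| + r(X)`, i.e.
  `|X| − r(X) ≤ |E| − r(E)`: `r(E) ≤ r(X) + |E ∖ X|` and `|X| + |E ∖ X| = |E|`.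
  Consequence (Proposition C₀ (Y) of §10): a set of rank `≤ q` in a matroid of nullity `d` has at most `q + d` elements.
Imports `OrbitK` (for `phiK`) only. Axioms: standard.
-/

namespace PercRepro

open Finset Set

/-- **`Φ(p, q) ≤ 2^{p+q} / C(p+q, p)`**. -/
theorem phiK_le_two_pow_div (p q : ℕ) : phiK p q ≤ (2 ^ (p + q) : ℚ) / ((p + q).choose p : ℚ) := by
  unfold phiK
  have hpos : (0 : ℚ) < ((p + q).choose p : ℚ) := by exact_mod_cast Nat.choose_pos (Nat.le_add_right p q)
  rw [div_le_div_iff_of_pos_right hpos]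
  have hsub : Finset.Ioo q p ⊆ Finset.range (p + q + 1) := by
    intro u hu
    rw [Finset.mem_Ioo] at hu
    rw [Finset.mem_range]
    omega
  calc (∑ u ∈ Finset.Ioo q p, ((p + q).choose u : ℚ))
      ≤ ∑ u ∈ Finset.range (p + q + 1), ((p + q).choose u : ℚ) :=
        Finset.sum_le_sum_of_subset_of_nonneg hsub (fun _ _ _ => by positivity)
    _ = ((∑ u ∈ Finset.range (p + q + 1), (p + q).choose u : ℕ) : ℚ) := by push_cast; rfl
    _ = (2 ^ (p + q) : ℚ) := by rw [Nat.sum_range_choose]; push_cast; rfl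

namespace Matroid

variable {α : Type*} {M : _root_.Matroid α}

/-- **Nullity is monotone** (additive form): for `X ⊆ E`, `|X| + r(E) ≤ |E| + r(X)`. -/
theorem encard_add_eRank_le {X : Set α} (hX : X ⊆ M.E) :
    X.encard + M.eRank ≤ M.E.encard + M.eRk X := by
  have h1 : M.eRank ≤ M.eRk X + (M.E \ X).encard := by
    have := M.eRk_union_le_eRk_add_encard X (M.E \ X)
    rw [Set.union_sdiff_cancel hX] at this
    rw [M.eRank_def]
    exact this
  have h2 : X.encard + (M.E \ X).encard = M.E.encard := by
    rw [add_comm]; exact Set.encard_sdiff_add_encard_of_subset hX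
  calc X.encard + M.eRank ≤ X.encard + (M.eRk X + (M.E \ X).encard) := by gcongr
    _ = (X.encard + (M.E \ X).encard) + M.eRk X := by ring
    _ = M.E.encard + M.eRk X := by rw [h2]

/-- A set of rank `≤ q` in a finite matroid with `|E| = r(E) + d` has at most `q + d` elements. -/
theorem encard_le_of_eRk_le [M.Finite] {X : Set α} (hX : X ⊆ M.E) {q d : ℕ}
    (hd : M.E.encard = M.eRank + d) (hq : M.eRk X ≤ q) : X.encard ≤ q + d := by
  have h := encard_add_eRank_le hX
  rw [hd] at h
  have hR : M.eRank ≠ ⊤ := (_root_.Matroid.eRank_ne_top_iff M).2 inferInstance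
  -- `|X| + r(E) ≤ r(E) + d + r(X)` ⇒ `|X| ≤ d + r(X) ≤ d + q`
  have h' : X.encard + M.eRank ≤ (d + M.eRk X) + M.eRank := by
    calc X.encard + M.eRank ≤ M.eRank + d + M.eRk X := h
      _ = (d + M.eRk X) + M.eRank := by ring
  have h'' : X.encard ≤ d + M.eRk X := (WithTop.add_le_add_iff_right hR).1 h'
  calc X.encard ≤ d + M.eRk X := h''
    _ ≤ d + q := by gcongr
    _ = q + d := by ring

end Matroid

/-! ### Counting subsets by size, and the two halves of Proposition C₀ (Y) -/

variable {α : Type*}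

/-- The subsets of a finset `E` with exactly `j` elements number `C(|E|, j)` (as a set of sets). -/
theorem ncard_subsets_ncard_eq (E : Finset α) (j : ℕ) :
    {X : Set α | X ⊆ (E : Set α) ∧ X.ncard = j}.ncard = E.card.choose j := by
  classical
  have himg : {X : Set α | X ⊆ (E : Set α) ∧ X.ncard = j} =
      (fun s : Finset α => (s : Set α)) '' ((E.powersetCard j : Finset (Finset α)) : Set (Finset α)) := by
    ext X
    simp only [Set.mem_setOf_eq, Set.mem_image, Finset.mem_coe, Finset.mem_powersetCard]
    constructor
    · rintro ⟨hXE, hXj⟩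
      have hXfin : X.Finite := (E.finite_toSet).subset hXE
      refine ⟨hXfin.toFinset, ⟨?_, ?_⟩, by simp⟩
      · intro x hx
        have := (Set.Finite.mem_toFinset hXfin).1 hx
        exact Finset.mem_coe.1 (hXE this)
      · rw [← hXj, Set.ncard_eq_toFinset_card X hXfin]
    · rintro ⟨s, ⟨hsE, hsj⟩, rfl⟩
      exact ⟨Finset.coe_subset.2 hsE, by rw [Set.ncard_coe_finset, hsj]⟩
  rw [himg, Set.ncard_image_of_injective _ Finset.coe_injective, Set.ncard_coe_finset,
    Finset.card_powersetCard]

/-- The subsets of a finset `E` with at most `k` elements number at most `Σ_{j ≤ k} C(|E|, j)`. -/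
theorem ncard_subsets_ncard_le (E : Finset α) (k : ℕ) :
    {X : Set α | X ⊆ (E : Set α) ∧ X.ncard ≤ k}.ncard ≤ ∑ j ∈ Finset.range (k + 1), E.card.choose j := by
  induction k with
  | zero =>
    rw [Finset.sum_range_one]
    rw [← ncard_subsets_ncard_eq E 0]
    apply Set.ncard_le_ncard
    · intro X hX; exact ⟨hX.1, Nat.le_zero.1 hX.2⟩
    · exact (E.finite_toSet.finite_subsets).subset (fun X hX => hX.1)
  | succ k ih =>
    rw [Finset.sum_range_succ]
    have hsplit : {X : Set α | X ⊆ (E : Set α) ∧ X.ncard ≤ k + 1} ⊆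
        {X : Set α | X ⊆ (E : Set α) ∧ X.ncard ≤ k} ∪ {X : Set α | X ⊆ (E : Set α) ∧ X.ncard = k + 1} := by
      intro X hX
      rcases Nat.lt_or_ge X.ncard (k + 1) with h | h
      · exact Or.inl ⟨hX.1, Nat.lt_succ_iff.1 h⟩
      · exact Or.inr ⟨hX.1, le_antisymm hX.2 h⟩
    calc {X : Set α | X ⊆ (E : Set α) ∧ X.ncard ≤ k + 1}.ncard
        ≤ ({X : Set α | X ⊆ (E : Set α) ∧ X.ncard ≤ k} ∪
            {X : Set α | X ⊆ (E : Set α) ∧ X.ncard = k + 1}).ncard :=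
          Set.ncard_le_ncard hsplit ((E.finite_toSet.finite_subsets.subset (fun X hX => hX.1)).union
            (E.finite_toSet.finite_subsets.subset (fun X hX => hX.1)))
      _ ≤ {X : Set α | X ⊆ (E : Set α) ∧ X.ncard ≤ k}.ncard +
            {X : Set α | X ⊆ (E : Set α) ∧ X.ncard = k + 1}.ncard := Set.ncard_union_le _ _
      _ ≤ (∑ j ∈ Finset.range (k + 1), E.card.choose j) + E.card.choose (k + 1) := by
          rw [ncard_subsets_ncard_eq]; gcongr

namespace Matroid

variable {α : Type*} {M : _root_.Matroid α} [M.Finite]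

/-- **Proposition C₀ (Y), first half**: in a finite matroid with `|E| = r(E) + d`, the sets of rank `≤ q` number at
most `Σ_{j ≤ q+d} C(|E|, j)`. -/
theorem ncard_eRk_le_le {q d : ℕ} (hd : M.E.encard = M.eRank + d) :
    {X : Set α | X ⊆ M.E ∧ M.eRk X ≤ q}.ncard ≤
      ∑ j ∈ Finset.range (q + d + 1), M.ground_finite.toFinset.card.choose j := by
  have hE : (M.ground_finite.toFinset : Set α) = M.E := Set.Finite.coe_toFinset _
  have hsub : {X : Set α | X ⊆ M.E ∧ M.eRk X ≤ q} ⊆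
      {X : Set α | X ⊆ (M.ground_finite.toFinset : Set α) ∧ X.ncard ≤ q + d} := by
    intro X hX
    refine ⟨by rw [hE]; exact hX.1, ?_⟩
    have h := encard_le_of_eRk_le hX.1 hd hX.2
    have hXfin : X.Finite := M.ground_finite.subset hX.1
    rw [← hXfin.cast_ncard_eq] at h
    exact_mod_cast h
  calc {X : Set α | X ⊆ M.E ∧ M.eRk X ≤ q}.ncard
      ≤ {X : Set α | X ⊆ (M.ground_finite.toFinset : Set α) ∧ X.ncard ≤ q + d}.ncard :=
        Set.ncard_le_ncard hsub ((M.ground_finite.toFinset.finite_toSet.finite_subsets).subset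
          (fun X hX => hX.1))
    _ ≤ ∑ j ∈ Finset.range (q + d + 1), M.ground_finite.toFinset.card.choose j :=
        ncard_subsets_ncard_le _ _

/-- **Proposition C₀ (Y), second half**: in a finite matroid with `|E| = r(E) + d`, the spanning sets number at most
`Σ_{j ≤ d} C(|E|, j)` (a spanning set misses at most `d` elements; `X ↦ E ∖ X` is injective). -/
theorem ncard_spanning_le {d : ℕ} (hd : M.E.encard = M.eRank + d) :
    {X : Set α | X ⊆ M.E ∧ M.eRk X = M.eRank}.ncard ≤
      ∑ j ∈ Finset.range (d + 1), M.ground_finite.toFinset.card.choose j := by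
  have hE : (M.ground_finite.toFinset : Set α) = M.E := Set.Finite.coe_toFinset _
  -- complement map
  have hinj : Set.InjOn (fun X : Set α => M.E \ X) {X : Set α | X ⊆ M.E ∧ M.eRk X = M.eRank} := by
    intro X hX Y hY hXY
    simp only at hXY
    rw [← Set.sdiff_sdiff_cancel_left hX.1, hXY, Set.sdiff_sdiff_cancel_left hY.1]
  have hmaps : ∀ X ∈ {X : Set α | X ⊆ M.E ∧ M.eRk X = M.eRank},
      (fun X : Set α => M.E \ X) X ∈ {Y : Set α | Y ⊆ (M.ground_finite.toFinset : Set α) ∧ Y.ncard ≤ d} := by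
    intro X hX
    refine ⟨by rw [hE]; exact Set.sdiff_subset, ?_⟩
    -- `r(E) ≤ r(X) + |E ∖ X|` gives nothing here; instead `|X| ≥ r(X) = r(E)` and `|X| + |E ∖ X| = |E| = r(E) + d`
    have h1 : M.eRank ≤ X.encard := by rw [← hX.2]; exact M.eRk_le_encard X
    have h2 : X.encard + (M.E \ X).encard = M.E.encard := by
      rw [add_comm]; exact Set.encard_sdiff_add_encard_of_subset hX.1
    have hXfin : X.Finite := M.ground_finite.subset hX.1
    have hR : M.eRank ≠ ⊤ := (_root_.Matroid.eRank_ne_top_iff M).2 inferInstance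
    have h3 : M.eRank + (M.E \ X).encard ≤ M.eRank + d := by
      calc M.eRank + (M.E \ X).encard ≤ X.encard + (M.E \ X).encard := by gcongr
        _ = M.E.encard := h2
        _ = M.eRank + d := hd
    have h4 : (M.E \ X).encard ≤ d := (WithTop.add_le_add_iff_left hR).1 h3
    have hfin : (M.E \ X).Finite := M.ground_finite.subset Set.sdiff_subset
    rw [← hfin.cast_ncard_eq] at h4
    exact_mod_cast h4
  calc {X : Set α | X ⊆ M.E ∧ M.eRk X = M.eRank}.ncard
      ≤ {Y : Set α | Y ⊆ (M.ground_finite.toFinset : Set α) ∧ Y.ncard ≤ d}.ncard :=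
        Set.ncard_le_ncard_of_injOn _ hmaps hinj
          ((M.ground_finite.toFinset.finite_toSet.finite_subsets).subset (fun X hX => hX.1))
    _ ≤ ∑ j ∈ Finset.range (d + 1), M.ground_finite.toFinset.card.choose j := ncard_subsets_ncard_le _ _

end Matroid

end PercRepro
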